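import Summits.AnomalousDissipation.AnomalousDissipation.Theses.MomentParity

/-!
# `MomentParity.Assembly` (stmt-AnomalousDissipation-11469): proof

`Summit.AnomalousDissipation.AnomalousDissipation.Theses.MomentParity.Assembly` is the assembly item
of route `AnomalousDissipation/MomentParity`:
`MomentLadder → MomentClosure → GalerkinEnsembleRealization → AnomalousDissipation`.
It is the pre-repair (rev ≤ 8) shape of the route's planner-authored deciding theorem
`Summit.AnomalousDissipation.AnomalousDissipation.Theses.MomentParity.closes` (D-0027 §2.1); since the
2026-08-16 badge repair `closes` has the crux-only shape
`GalerkinInvariantLoud → ResolvedDissipation → LadderGlue → MomentClosure →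
GalerkinEnsembleRealization → AnomalousDissipation` and derives `MomentLadder` on its first line, so it
can no longer be re-applied here. The proof below is therefore the body of `closes` from the point
where `MomentLadder` is in hand: unpack the moment ladder `(f, ν, E, ε)`, turn loud `d`-stationary
measures into a loud Galerkin-invariant measure at frequently many resolutions (`MomentClosure`), and
shadow them by one global Leray–Hopf trajectory with bounded mean energy and mean dissipation `≥ ε / 2`
(`GalerkinEnsembleRealization`), which witnesses `Literature.Turb.ZerothLaw = AnomalousDissipation`.
Sources of the route step: FMRT 2001 (Foias–Manley–Rosa–Temam), doi:10.1137/130931631.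
-/

-- `Summit.<Summit>.<Problem>` is the tree's mandated summit-side namespace (CONVENTIONS §2); for this
-- single-conjunct summit the two coincide, so the duplicate is deliberate.
set_option linter.dupNamespace false

namespace Summit.AnomalousDissipation.AnomalousDissipation.Theorems

open Summit.AnomalousDissipation.AnomalousDissipation.Theses.MomentParity

/-- **Assembly of route `MomentParity`** (item stmt-AnomalousDissipation-11469):
`MomentLadder → MomentClosure → GalerkinEnsembleRealization → AnomalousDissipation`.
Proof: unpack the force `f`, the viscosities `ν j → 0` and the budgets `E`, `ε` from `MomentLadder`;
`GalerkinEnsembleRealization` supplies a `j`-independent `M = M(f, E, ε)`; at each `j`,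
`MomentClosure` turns "loud `d`-stationary measures for every `d` (common support ball, resolved
dissipation)" into a loud Galerkin-invariant measure at frequently many levels `N`
(`Filter.Frequently.mono`), and `GalerkinEnsembleRealization` shadows them by one global Leray–Hopf
trajectory with `meanEnergy ≤ M` and `meanDissipation ≥ ε / 2`; these witness
`Literature.Turb.ZerothLaw` (= `AnomalousDissipation`) with constants `M`, `ε / 2`.
[route AnomalousDissipation/MomentParity; FMRT2001; doi:10.1137/130931631] -/
theorem momentParity_assembly_proof :
    Summit.AnomalousDissipation.AnomalousDissipation.Theses.MomentParity.Assembly := by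
  unfold Summit.AnomalousDissipation.AnomalousDissipation.Theses.MomentParity.Assembly
  intro hX hC hR
  obtain ⟨f, hfs, hfd, hfz, ν, E, ε, hν, hν0, hε, hj⟩ := hX
  obtain ⟨M, hM⟩ := hR f hfs hfd hfz E ε hε
  have key : ∀ j : ℕ, ∃ (u₀ : UnitAddTorus (Fin 3) → EuclideanSpace ℝ (Fin 3))
      (u : ℝ → UnitAddTorus (Fin 3) → EuclideanSpace ℝ (Fin 3)),
      Literature.Analysis.FluidPDE.Torus.IsGlobalLerayHopf (ν j) (fun _ => f) u₀ u ∧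
        Literature.Analysis.FluidPDE.meanEnergy u ≤ M ∧
          ε / 2 ≤ Literature.Analysis.FluidPDE.meanDissipation (ν j) u := by
    intro j
    obtain ⟨R, κ, hfreq⟩ := hj j
    exact hM (ν j) (hν j) R κ (hfreq.mono fun N hN => hC f hfs hfd hfz (ν j) N E ε R κ (hν j) hN)
  choose u₀ u hu using key
  unfold _root_.AnomalousDissipation Literature.Turb.ZerothLaw
  exact ⟨f, hfs, hfd, hfz, ν, u₀, u, hν, hν0, fun j => (hu j).1, ⟨M, fun j => (hu j).2.1⟩,
    ε / 2, half_pos hε, fun j => (hu j).2.2⟩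

end Summit.AnomalousDissipation.AnomalousDissipation.Theorems
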